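import Literature.Analysis.FluidPDE.NSLerayHopf
import Literature.Analysis.FluidPDE.LerayHopfGalileanTorusTools
import Literature.Analysis.FluidPDE.LerayHopfGalileanTorusTest
import Literature.Analysis.FluidPDE.WeakSolution
import Literature.Analysis.FluidPDE.LerayHopfTranslateTorusTools
import Literature.Analysis.FunctionSpaces.TorusWeakFormBookkeeping
import Literature.Analysis.FluidPDE.TorusWeakNSGluing
import HarnessLib

/-!
# Galilean covariance of forced weak Navier–Stokes solutions on the flat torus

Analysis/FluidPDE support file (all proved).  Let `u` be a forced weak (pressure-free) solution of the
Navier–Stokes equations on `T^d × [0, T)` with datum `u₀` and a STEADY smooth force `f`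
(`Torus.IsWeakNSSolutionForcedOn T ν (fun _ => f) u₀ u`; Temam, *Navier–Stokes Equations*, Ch. III §1.1,
(1.22)–(1.23)).  For a constant velocity `V ∈ ℝ^d` write `[tV] := proj (t • V) ∈ T^d`.  Then the field seen
from the frame moving with velocity `V`, `v t y := u t (y + [tV]) - V`, is a forced weak solution on
`T^d × [0, T)` with datum `u₀ - V` and the swept force `g t y := f (y + [tV])`
(`IsWeakNSSolutionForcedOn.galilean_unboost`).  This is the weak form of the Galilean invariance of the
Navier–Stokes equations (U. Frisch, *Turbulence* (1995), §2.2).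

Proof.  Given a divergence-free test field `ψ` for `v`, the transported field `ψ̃ t x := ψ t (x - [tV])`
(`LerayHopfGalileanTorusTest`) is a divergence-free test field for `u`, with
`∂ₜψ̃(t, x) = ∂ₜψ(t, y) - Dψₜ(y)[V]`, `y = x - [tV]`.  At a.e. time (where `u t ∈ L²` is weakly divergence
free) the slice functional of `v` against `ψ` equals the slice functional of `u` against `ψ̃` minus
`∫ ⟪V, ∂ₜψ(t)⟫` (`integral_galilean_slice`: after the change of variables `x = y + [tV]` the frame terms
`∫⟪V, Dψₜ[u]⟫`, `∫⟪V, Dψₜ[V]⟫`, `∫⟪V, Δψₜ⟫` vanish).  Integrating in time, `∫₀ᵀ ∫⟪V, ∂ₜψ⟫ = -∫⟪V, ψ 0⟫`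
cancels against the datum term `∫⟪-V, ψ 0⟫`.  Measurability and square integrability of `v` follow from the
measure-preserving shear `(t, ỹ) ↦ (t, ỹ + tV)` of `(0, T) × ℝ^d` and the slice bound
`∫‖u(· + a) − V‖² ≤ 2∫‖u‖² + 2‖V‖²` (`LerayHopfGalileanTorusTools`).

## References

* U. Frisch, *Turbulence: the legacy of A. N. Kolmogorov* (CUP 1995), §2.2 (symmetries; Galilean
  invariance of Navier–Stokes on the periodic box).
* R. Temam, *Navier–Stokes Equations*, 3rd ed. (1984), Ch. III §1.1, (1.22)–(1.25).

*Imports (module hygiene, 2026-08-16, refactor item `defn-NSLerayHopfOpenFacts`):* the hub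
`Literature.Analysis.FluidPDE.NSLerayHopf` is imported explicitly (this file uses its
declarations), since `NSHopfGalerkin` — through which it used to arrive — no longer imports it.
-/

noncomputable section

open MeasureTheory Set Filter Topology
open scoped InnerProductSpace RealInnerProductSpace ENNReal NNReal ContDiff

namespace Literature.Analysis.FluidPDE.Torus

open Literature.Analysis.FunctionSpaces Literature.Analysis.FunctionSpaces.Torus UnitAddTorus

variable {d : Type*} [Fintype d] [DecidableEq d]

/-! ### The slice identity -/

section Slice

/-- **Slice identity of the Galilean change of frame.**  For `w ∈ L²(T^d)` weakly divergence
free (the translated slice `u(t, · + [tV])`), smooth `g, φ, χ` (force slice, test slice, its time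
derivative) and a frame velocity `V`:
`∫ (⟪w − V, χ⟫ + ⟪w − V, Dφ[w − V]⟫ + ν⟪w − V, Δφ⟫ + ⟪g, φ⟫)
 = ∫ (⟪w, χ − Dφ[V]⟫ + ⟪w, Dφ[w]⟫ + ν⟪w, Δφ⟫ + ⟪g, φ⟫) − ∫ ⟪V, χ⟫`,
because the remaining frame terms `∫⟪V, Dφ[w]⟫`, `∫⟪V, Dφ[V]⟫`, `∫⟪V, Δφ⟫` vanish. [folklore] -/
theorem integral_galilean_slice {w g φ χ : UnitAddTorus d → EuclideanSpace ℝ d}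
    (hw : MemLp w 2 volume) (hdiv : Torus.IsWeaklyDivFree w) (hg : IsSmooth g) (hφ : IsSmooth φ)
    (hχ : IsSmooth χ) (ν : ℝ) (V : EuclideanSpace ℝ d) :
    ∫ y, (⟪w y - V, χ y⟫ + ⟪w y - V, Torus.convect (fun z => w z - V) φ y⟫ +
        ν * ⟪w y - V, Torus.laplacian φ y⟫ + ⟪g y, φ y⟫) =
      (∫ y, (⟪w y, χ y - Torus.fderiv φ y V⟫ + ⟪w y, Torus.convect w φ y⟫ +
        ν * ⟪w y, Torus.laplacian φ y⟫ + ⟪g y, φ y⟫)) - ∫ y, ⟪V, χ y⟫ := by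
  have hwi : Integrable w volume := hw.integrable one_le_two
  have hDV : Continuous fun y => Torus.fderiv φ y V := ((isSmooth_const V).convect hφ).continuous
  -- integrability of the pieces
  have i1 : Integrable (fun y => ⟪w y, χ y - Torus.fderiv φ y V⟫) volume :=
    integrable_inner_of_continuous hwi (hχ.continuous.sub hDV)
  have i2 : Integrable (fun y => ⟪w y, Torus.convect w φ y⟫) volume := integrable_inner_convect_self hw hφ
  have i3 : Integrable (fun y => ⟪w y, Torus.laplacian φ y⟫) volume :=
    integrable_inner_of_continuous hwi hφ.laplacian.continuous
  have i4 : Integrable (fun y => ⟪g y, φ y⟫) volume := integrable_inner_of_continuous hg.integrable hφ.continuous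
  have j1 : Integrable (fun y => ⟪V, χ y⟫) volume :=
    integrable_inner_of_continuous (integrable_const V) hχ.continuous
  have j2 : Integrable (fun y => ⟪V, Torus.fderiv φ y (w y)⟫) volume := by
    have h : (fun y => ⟪V, Torus.fderiv φ y (w y)⟫) =
        fun y => ⟪w y, Torus.gradient (fun z => ⟪V, φ z⟫) y⟫ :=
      funext fun y => inner_fderiv_apply_eq_inner_gradient hφ V (w y) y
    rw [h]
    exact integrable_inner_of_continuous hwi ((isSmooth_const V).inner hφ).gradient.continuous
  have j3 : Integrable (fun y => ⟪V, Torus.fderiv φ y V⟫) volume :=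
    integrable_inner_of_continuous (integrable_const V) hDV
  have j4 : Integrable (fun y => ⟪V, Torus.laplacian φ y⟫) volume :=
    integrable_inner_of_continuous (integrable_const V) hφ.laplacian.continuous
  -- pointwise expansion
  have hpt : ∀ y, ⟪w y - V, χ y⟫ + ⟪w y - V, Torus.convect (fun z => w z - V) φ y⟫ +
      ν * ⟪w y - V, Torus.laplacian φ y⟫ + ⟪g y, φ y⟫ =
      (⟪w y, χ y - Torus.fderiv φ y V⟫ + ⟪w y, Torus.convect w φ y⟫ +
        ν * ⟪w y, Torus.laplacian φ y⟫ + ⟪g y, φ y⟫) +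
      (⟪V, Torus.fderiv φ y V⟫ - ⟪V, χ y⟫ - ⟪V, Torus.fderiv φ y (w y)⟫ -
        ν * ⟪V, Torus.laplacian φ y⟫) := by
    intro y
    simp only [Torus.convect, map_sub, inner_sub_left, inner_sub_right]
    ring
  have j31 : Integrable (fun y => ⟪V, Torus.fderiv φ y V⟫ - ⟪V, χ y⟫) volume := j3.sub j1
  have j312 : Integrable (fun y => ⟪V, Torus.fderiv φ y V⟫ - ⟪V, χ y⟫ - ⟪V, Torus.fderiv φ y (w y)⟫) volume :=
    j31.sub j2
  have iE : Integrable (fun y => ⟪V, Torus.fderiv φ y V⟫ - ⟪V, χ y⟫ - ⟪V, Torus.fderiv φ y (w y)⟫ -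
      ν * ⟪V, Torus.laplacian φ y⟫) volume := j312.sub (j4.const_mul ν)
  have iR : Integrable (fun y => ⟪w y, χ y - Torus.fderiv φ y V⟫ + ⟪w y, Torus.convect w φ y⟫ +
      ν * ⟪w y, Torus.laplacian φ y⟫ + ⟪g y, φ y⟫) volume := ((i1.add i2).add (i3.const_mul ν)).add i4
  have hframe : ∫ y, (⟪V, Torus.fderiv φ y V⟫ - ⟪V, χ y⟫ - ⟪V, Torus.fderiv φ y (w y)⟫ -
      ν * ⟪V, Torus.laplacian φ y⟫) = -∫ y, ⟪V, χ y⟫ := by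
    rw [integral_sub j312 (j4.const_mul ν), integral_sub j31 j2, integral_sub j3 j1, integral_const_mul,
      integral_inner_fderiv_apply_const_eq_zero hφ V,
      integral_inner_fderiv_apply_eq_zero_of_isWeaklyDivFree hdiv hφ V,
      integral_inner_laplacian_const_eq_zero hφ V]
    ring
  rw [integral_congr_ae (ae_of_all _ hpt), integral_add iR iE, hframe]
  ring

end Slice

/-! ### Space–time bookkeeping of the change of frame -/

section SpaceTime

omit [DecidableEq d] in
/-- **Measurability in the moving frame.**  The lift of `(t, y) ↦ u t (y + [tV]) - V` is the lift of
`u` composed with the shear `(t, ỹ) ↦ (t, ỹ + tV)`, which preserves Lebesgue measure on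
`(0, T) × ℝ^d`, minus a constant. [folklore] -/
theorem aestronglyMeasurable_stLift_comp_add_proj_smul {T : ℝ} {u : ℝ → UnitAddTorus d → EuclideanSpace ℝ d}
    (hm : AEStronglyMeasurable (stLift u) (volume.restrict (Ioo 0 T ×ˢ univ))) (V : EuclideanSpace ℝ d) :
    AEStronglyMeasurable (stLift fun t y => u t (y + proj (t • V)) - V)
      (volume.restrict (Ioo 0 T ×ˢ (univ : Set (EuclideanSpace ℝ d)))) := by
  set Θ : ℝ × EuclideanSpace ℝ d → ℝ × EuclideanSpace ℝ d := fun p => (p.1, p.2 + p.1 • V) with hΘ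
  have h0 : MeasurePreserving Θ (volume : Measure (ℝ × EuclideanSpace ℝ d)) volume :=
    (MeasurePreserving.id (volume : Measure ℝ)).skew_product (g := fun (t : ℝ) (y : EuclideanSpace ℝ d) => y + t • V)
      (measurable_snd.add (measurable_fst.smul_const V))
      (ae_of_all _ fun t => (measurePreserving_add_right volume (t • V)).map_eq)
  have hS : MeasurableSet (Ioo 0 T ×ˢ (univ : Set (EuclideanSpace ℝ d))) :=
    measurableSet_Ioo.prod MeasurableSet.univ
  have h1 := h0.restrict_preimage hS
  have hpre : Θ ⁻¹' (Ioo 0 T ×ˢ univ) = Ioo 0 T ×ˢ univ := by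
    ext p
    simp [hΘ]
  rw [hpre] at h1
  have hg : (stLift fun t y => u t (y + proj (t • V)) - V) = fun p => (stLift u ∘ Θ) p - V := by
    funext p
    rfl
  rw [hg]
  exact (hm.comp_measurePreserving h1).sub aestronglyMeasurable_const

omit [DecidableEq d] in
/-- **Square integrability in the moving frame**: `∫₀ᵀ ∫ ‖u(t, · + [tV]) − V‖² ≤ 2∫₀ᵀ∫‖u‖² + 2T‖V‖² < ∞`.
[folklore] -/
theorem lintegral_enorm_sq_comp_add_proj_smul_lt_top {T : ℝ} {u : ℝ → UnitAddTorus d → EuclideanSpace ℝ d}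
    (h2 : ∫⁻ t in Ioo 0 T, ∫⁻ x, ‖u t x‖ₑ ^ 2 < ⊤) (V : EuclideanSpace ℝ d) :
    ∫⁻ t in Ioo 0 T, ∫⁻ y, ‖u t (y + proj (t • V)) - V‖ₑ ^ 2 < ⊤ := by
  calc ∫⁻ t in Ioo 0 T, ∫⁻ y, ‖u t (y + proj (t • V)) - V‖ₑ ^ 2
      ≤ ∫⁻ t in Ioo 0 T, (2 * (∫⁻ x, ‖u t x‖ₑ ^ 2) + 2 * ‖V‖ₑ ^ 2) :=
        lintegral_mono fun t => lintegral_enorm_sq_comp_add_right_sub_const_le (u t) _ V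
    _ = 2 * (∫⁻ t in Ioo 0 T, ∫⁻ x, ‖u t x‖ₑ ^ 2) + 2 * ‖V‖ₑ ^ 2 * volume (Ioo (0 : ℝ) T) := by
        rw [lintegral_add_right _ measurable_const, lintegral_const_mul' _ _ ENNReal.ofNat_ne_top,
          setLIntegral_const]
    _ < ⊤ := ENNReal.add_lt_top.2 ⟨ENNReal.mul_lt_top ENNReal.ofNat_lt_top h2,
        ENNReal.mul_lt_top (ENNReal.mul_lt_top ENNReal.ofNat_lt_top (ENNReal.pow_lt_top enorm_lt_top))
          measure_Ioo_lt_top⟩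

end SpaceTime

/-! ### The theorem -/

section Main

/-- **Galilean covariance of forced weak Navier–Stokes solutions on `T^d`.**  If `u` is a forced weak
solution on `T^d × [0, T)` with datum `u₀ ∈ L¹` and a steady smooth force `f`, then for every constant
velocity `V` the field `(t, y) ↦ u t (y + [tV]) - V` seen from the frame moving with velocity `V` is a
forced weak solution on `T^d × [0, T)` with datum `u₀ - V` and the swept force `(t, y) ↦ f (y + [tV])`,
`[tV] = proj (t • V)` (U. Frisch, *Turbulence* (1995), §2.2, Galilean invariance; weak formulation of
Temam, Ch. III §1.1: test the identity of `u` with the transported field `ψ(t, · - [tV])`). [folklore] -/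
theorem IsWeakNSSolutionForcedOn.galilean_unboost
    {T ν : ℝ} {f : UnitAddTorus d → EuclideanSpace ℝ d} {u₀ : UnitAddTorus d → EuclideanSpace ℝ d}
    {u : ℝ → UnitAddTorus d → EuclideanSpace ℝ d}
    (hu : IsWeakNSSolutionForcedOn T ν (fun _ => f) u₀ u) (hf : FunctionSpaces.Torus.IsSmooth f)
    (hu₀ : Integrable u₀ volume) (V : EuclideanSpace ℝ d) :
    IsWeakNSSolutionForcedOn T ν (fun t y => f (y + FunctionSpaces.Torus.proj (t • V))) (fun y => u₀ y - V)
      (fun t y => u t (y + FunctionSpaces.Torus.proj (t • V)) - V) := by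
  obtain ⟨hm, h2, hdivae, hweak⟩ := hu
  have hae2 := ae_memLp_two_slice_of_lintegral hm h2
  refine ⟨aestronglyMeasurable_stLift_comp_add_proj_smul hm V,
    lintegral_enorm_sq_comp_add_proj_smul_lt_top h2 V, ?_, fun ψ hψ hdiv => ?_⟩
  · -- weak incompressibility of a.e. slice
    filter_upwards [hdivae, hae2] with t hdt ht
    exact isWeaklyDivFree_comp_add_right_sub_const hdt (ht.integrable one_le_two) _ V
  · -- the weak identity: test `u` with the transported field `ψ' t x = ψ t (x - [tV])`
    obtain ⟨ψ', hψ'def⟩ : ∃ ψ' : ℝ → UnitAddTorus d → EuclideanSpace ℝ d,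
        ψ' = fun s z => ψ s (z - proj (s • V)) := ⟨_, rfl⟩
    have hψ' : IsSpaceTimeTest T ψ' := hψ'def ▸ isSpaceTimeTest_comp_sub_proj_smul hψ V
    have hdiv' : IsDivFreeTest ψ' := hψ'def ▸ isDivFreeTest_comp_sub_proj_smul hdiv V
    have hψ'0 : ψ' 0 = ψ 0 := by
      rw [hψ'def]
      exact comp_sub_proj_smul_zero ψ V
    have hψ't : ∀ t x, ψ' t x = ψ t (x - proj (t • V)) := fun t x => by rw [hψ'def]
    have hψ'dt : ∀ t x, Torus.timeDeriv ψ' t x =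
        Torus.timeDeriv ψ t (x - proj (t • V)) - Torus.fderiv (ψ t) (x - proj (t • V)) V := fun t x => by
      rw [hψ'def]
      exact timeDeriv_comp_sub_proj_smul hψ.1 V t x
    have hψ'D : ∀ t x, Torus.fderiv (ψ' t) x = Torus.fderiv (ψ t) (x - proj (t • V)) := fun t x => by
      rw [hψ'def]
      exact fderiv_comp_sub (ψ t) _ x
    have hψ'L : ∀ t x, Torus.laplacian (ψ' t) x = Torus.laplacian (ψ t) (x - proj (t • V)) := fun t x => by
      rw [hψ'def]
      exact laplacian_comp_sub (ψ t) _ x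
    have hid := hweak ψ' hψ' hdiv'
    rw [hψ'0] at hid
    -- integrability in time of the functional of `u` against `ψ'`
    have hΦu : IntegrableOn (fun t => ∫ x, (⟪u t x, Torus.timeDeriv ψ' t x⟫ +
        ⟪u t x, Torus.convect (u t) (ψ' t) x⟫ + ν * ⟪u t x, Torus.laplacian (ψ' t) x⟫ + ⟪f x, ψ' t x⟫))
        (Ioo 0 T) := by
      obtain ⟨Kq, hKq⟩ := hψ'.exists_bound (isCompact_Icc (a := 0) (b := T))
      have hGi : IntegrableOn (fun t => ∫ x, ⟪f x, ψ' t x⟫) (Ioo 0 T) :=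
        integrableOn_integral_inner_of_lintegral (U := fun _ => f) (aestronglyMeasurable_stLift_const hf _)
          (lintegral_enorm_sq_const_lt_top hf _) hψ'.continuous_uncurry
          (fun t ht x => hKq t (Ioo_subset_Icc_self ht) x)
      refine ((integrableOn_nsWeakFunctional (ν := ν) hm h2 hψ').add hGi).congr_fun_ae ?_
      filter_upwards [hae2] with t ht
      have hi : Integrable (u t) volume := ht.integrable one_le_two
      have i1 : Integrable (fun x => ⟪u t x, Torus.timeDeriv ψ' t x⟫ +
          ⟪u t x, Torus.convect (u t) (ψ' t) x⟫ + ν * ⟪u t x, Torus.laplacian (ψ' t) x⟫) volume :=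
        ((integrable_inner_of_continuous hi (hψ'.timeDeriv.isSmooth_slice t).continuous).add
          (integrable_inner_convect_slice hψ' ht)).add
          ((integrable_inner_of_continuous hi (hψ'.isSmooth_slice t).laplacian.continuous).const_mul ν)
      have i2 : Integrable (fun x => ⟪f x, ψ' t x⟫) volume :=
        integrable_inner_of_continuous hf.integrable (hψ'.isSmooth_slice t).continuous
      exact (integral_add i1 i2).symm
    -- integrability in time of the frame functional `t ↦ ∫ ⟪V, ∂ₜψ t⟫`
    have hC : IntegrableOn (fun t => ∫ y, ⟪V, Torus.timeDeriv ψ t y⟫) (Ioo 0 T) := by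
      obtain ⟨Kp, hKp⟩ := hψ.exists_bound_timeDeriv (isCompact_Icc (a := 0) (b := T))
      exact integrableOn_integral_inner_of_lintegral (U := fun (_ : ℝ) (_ : UnitAddTorus d) => V)
        (aestronglyMeasurable_stLift_const (isSmooth_const V) _)
        (lintegral_enorm_sq_const_lt_top (isSmooth_const V) _) hψ.timeDeriv.continuous_uncurry
        (fun t ht x => hKp t (Ioo_subset_Icc_self ht) x)
    -- the slice identity at a.e. time
    have hslice : ∀ᵐ t ∂(volume.restrict (Ioo 0 T)),
        ∫ y, (⟪u t (y + proj (t • V)) - V, Torus.timeDeriv ψ t y⟫ +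
          ⟪u t (y + proj (t • V)) - V, Torus.convect (fun z => u t (z + proj (t • V)) - V) (ψ t) y⟫ +
          ν * ⟪u t (y + proj (t • V)) - V, Torus.laplacian (ψ t) y⟫ + ⟪f (y + proj (t • V)), ψ t y⟫) =
        (∫ x, (⟪u t x, Torus.timeDeriv ψ' t x⟫ + ⟪u t x, Torus.convect (u t) (ψ' t) x⟫ +
          ν * ⟪u t x, Torus.laplacian (ψ' t) x⟫ + ⟪f x, ψ' t x⟫)) - ∫ y, ⟪V, Torus.timeDeriv ψ t y⟫ := by
      filter_upwards [hae2, hdivae] with t ht hdt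
      have hw : MemLp (fun y => u t (y + proj (t • V))) 2 volume :=
        ht.comp_measurePreserving (measurePreserving_add_right volume (proj (t • V)))
      have hwdiv : Torus.IsWeaklyDivFree (fun y => u t (y + proj (t • V))) := by
        simpa only [sub_zero] using
          isWeaklyDivFree_comp_add_right_sub_const hdt (ht.integrable one_le_two) (proj (t • V)) 0
      have key := integral_galilean_slice hw hwdiv (hf.comp_add_right (proj (t • V))) (hψ.isSmooth_slice t)
        (hψ.timeDeriv.isSmooth_slice t) ν V
      have hcv : ∫ x, (⟪u t x, Torus.timeDeriv ψ' t x⟫ + ⟪u t x, Torus.convect (u t) (ψ' t) x⟫ +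
          ν * ⟪u t x, Torus.laplacian (ψ' t) x⟫ + ⟪f x, ψ' t x⟫) =
          ∫ y, (⟪u t (y + proj (t • V)), Torus.timeDeriv ψ t y - Torus.fderiv (ψ t) y V⟫ +
            ⟪u t (y + proj (t • V)), Torus.convect (fun z => u t (z + proj (t • V))) (ψ t) y⟫ +
            ν * ⟪u t (y + proj (t • V)), Torus.laplacian (ψ t) y⟫ + ⟪f (y + proj (t • V)), ψ t y⟫) := by
        rw [← integral_add_right_eq_self (fun x => ⟪u t x, Torus.timeDeriv ψ' t x⟫ +
          ⟪u t x, Torus.convect (u t) (ψ' t) x⟫ + ν * ⟪u t x, Torus.laplacian (ψ' t) x⟫ + ⟪f x, ψ' t x⟫)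
          (proj (t • V))]
        refine integral_congr_ae (ae_of_all _ fun y => ?_)
        simp only [Torus.convect, hψ't, hψ'dt, hψ'D, hψ'L, add_sub_cancel_right]
      rw [hcv]
      exact key
    -- the datum
    have hdat : ∫ y, ⟪u₀ y - V, ψ 0 y⟫ = (∫ y, ⟪u₀ y, ψ 0 y⟫) - ∫ y, ⟪V, ψ 0 y⟫ := by
      rw [← integral_sub (integrable_inner_of_continuous hu₀ (hψ.isSmooth_slice 0).continuous)
        (integrable_inner_of_continuous (integrable_const V) (hψ.isSmooth_slice 0).continuous)]
      simp only [inner_sub_left]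
    rw [integral_congr_ae hslice, integral_sub hΦu hC, setIntegral_integral_inner_timeDeriv_const hψ V,
      hdat]
    linarith

end Main

end Literature.Analysis.FluidPDE.Torus

end
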